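import Literature.RepresentationTheory.ModularTensorCategories.KLRacahNorm

/-!
# The norm of an extremal column in every orientation, and the orthogonality of the Kauffman–Lins Racah sums

`KLRacahNorm.lean` computes `Σ_i ṽ_i S_{i,a-b}² = 1/v_{a-b}` for labels normalised so that `b ≤ a`,
`|c - d| ≤ a - b` and `a + b + c + d ≤ 2k`. Here the two remaining reductions are carried out:

* the **level conjugation** `(a,b,c,d) ↦ (k-b, k-a, k-d, k-c)`, which preserves admissibility, the row and column
  sets, the weights `v, ṽ` and the squares of the extremal column (all through the reflection formula
  `[u]! [k+1-u]! = [k+1]!` at `q = e^{iπ/(k+2)}`), and maps `a + b + c + d > 2k` to `< 2k` (`racahSum_norm_N1`);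
* the **orientations** `(b,a,d,c), (c,d,a,b), (d,c,b,a)`, under which `S`, `v`, `ṽ` and the row/column sets are
  literally invariant, one of which is always normalised (`racahSum_norm_exists`).

Consequently the hypothesis of `racahSum_gram_of_norm` is always met and the Racah sums are orthogonal with the
predicted norms for all labels at level `k ≥ 1` (`racahSum_gram`). [cite: KauffmanLins1994, §9.11–9.13]
[cite: GasperRahman2004, §7.2 (7.2.15)–(7.2.18)]
-/

noncomputable section

namespace Literature.RepresentationTheory.ModularTensorCategories.SU2LevelK

open Finset

variable (k : ℕ)

/-! ### Reflection at the root of unity -/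

/-- `[m] = [k+2-m]` (`sin x = sin (π - x)`). [cite: KauffmanLins1994, §9.8] -/
theorem qInt_reflect {m : ℕ} (hm : m ≤ k + 2) : qInt k m = qInt k (k + 2 - m) := by
  unfold qInt
  congr 1
  have hk : (k : ℝ) + 2 ≠ 0 := by positivity
  rw [Nat.cast_sub hm, show (((k + 2 : ℕ) : ℝ) - m) * Real.pi / (k + 2) = Real.pi - m * Real.pi / (k + 2) by
    push_cast; rw [sub_mul, sub_div, mul_div_cancel_left₀ _ hk], Real.sin_pi_sub]

/-- **Reflection formula** `[u]! [k+1-u]! = [k+1]!` for `u ≤ k + 1`. [cite: KauffmanLins1994, §9.8] -/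
theorem qFactorial_reflect {u : ℕ} (hu : u ≤ k + 1) : qFactorial k u * qFactorial k (k + 1 - u) = qFactorial k (k + 1) := by
  induction u with
  | zero => simp [qFactorial_zero]
  | succ u ih =>
    have ih := ih (by omega)
    rw [show k + 1 - u = (k + 1 - (u + 1)) + 1 by omega, qFactorial_succ] at ih
    rw [qFactorial_succ, qInt_reflect k (m := u + 1) (by omega), show k + 2 - (u + 1) = k + 1 - (u + 1) + 1 by omega]
    linear_combination ih

/-- Level conjugation preserves admissibility: `(k-a, k-b, j)` is admissible iff `(a, b, j)` is (triangle and level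
conditions are exchanged). [cite: KauffmanLins1994, §9.8–9.9] -/
theorem adm_conj {a b j : ℕ} (ha : a ≤ k) (hb : b ≤ k) : Adm k (k - a) (k - b) j ↔ Adm k a b j := by
  unfold Adm; omega

/-- The row set is invariant under level conjugation (combined with the orientation `(b,a,d,c)`). [folklore] -/
theorem rowSet_conj {a b c d : ℕ} (ha : a ≤ k) (hb : b ≤ k) (hc : c ≤ k) (hd : d ≤ k) :
    rowSet k (k - b) (k - a) (k - d) (k - c) = rowSet k a b c d := by
  unfold rowSet
  refine filter_congr fun i hi => ?_
  rw [mem_range] at hi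
  rw [adm_conj k hb hc, adm_conj k ha hd]
  exact and_comm

/-- The weight `v` is invariant under level conjugation. [folklore] -/
theorem racahV_conj {a b c d j : ℕ} (ha : a ≤ k) (hb : b ≤ k) (hc : c ≤ k) (hd : d ≤ k) (habj : Adm k a b j)
    (hcdj : Adm k c d j) : racahV k (k - a) (k - b) (k - c) (k - d) j = racahV k a b c d j := by
  unfold Adm at habj hcdj
  obtain ⟨p1, t1, t2, t3, l1⟩ := habj
  obtain ⟨p2, s1, s2, s3, l2⟩ := hcdj
  unfold racahV
  -- the halves, division-free
  generalize hA : (a + b + j) / 2 = A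
  generalize hC : (c + d + j) / 2 = C
  generalize hm₂ : (a + b - j) / 2 = m₂
  generalize hm₁ : (c + d - j) / 2 = m₁
  have hA2 : 2 * A = a + b + j := by omega
  have hC2 : 2 * C = c + d + j := by omega
  have hm22 : 2 * m₂ = a + b - j := by omega
  have hm12 : 2 * m₁ = c + d - j := by omega
  clear hA hC hm₂ hm₁
  have e1 : (k - b + j - (k - a)) / 2 = (a + j - b) / 2 := by omega
  have e2 : (k - d + j - (k - c)) / 2 = (c + j - d) / 2 := by clear e1; omega
  have e3 : (k - c + j - (k - d)) / 2 = (d + j - c) / 2 := by clear e1 e2; omega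
  have e4 : (k - a + j - (k - b)) / 2 = (b + j - a) / 2 := by clear e1 e2 e3; omega
  have e5 : (k - c + (k - d) - j) / 2 = k - C := by clear e1 e2 e3 e4; omega
  have e6 : (k - a + (k - b) - j) / 2 = k - A := by clear e1 e2 e3 e4 e5; omega
  have e7 : (k - a + (k - b) + j) / 2 + 1 = k + 1 - m₂ := by clear e1 e2 e3 e4 e5 e6; omega
  have e8 : (k - c + (k - d) + j) / 2 + 1 = k + 1 - m₁ := by clear e1 e2 e3 e4 e5 e6 e7; omega
  rw [e1, e2, e3, e4, e5, e6, e7, e8]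
  clear e1 e2 e3 e4 e5 e6 e7 e8
  -- the four reflections
  have r1 : qFactorial k (C + 1) * qFactorial k (k - C) = qFactorial k (k + 1) := by
    rw [show k - C = k + 1 - (C + 1) by omega]; exact qFactorial_reflect k (by omega)
  have r2 : qFactorial k (A + 1) * qFactorial k (k - A) = qFactorial k (k + 1) := by
    rw [show k - A = k + 1 - (A + 1) by omega]; exact qFactorial_reflect k (by omega)
  have r3 : qFactorial k m₂ * qFactorial k (k + 1 - m₂) = qFactorial k (k + 1) := qFactorial_reflect k (by omega)
  have r4 : qFactorial k m₁ * qFactorial k (k + 1 - m₁) = qFactorial k (k + 1) := qFactorial_reflect k (by omega)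
  have h1 : qFactorial k (C + 1) ≠ 0 := (qFactorial_pos k (by omega)).ne'
  have h2 : qFactorial k (A + 1) ≠ 0 := (qFactorial_pos k (by omega)).ne'
  have h3 : qFactorial k (k + 1 - m₂) ≠ 0 := (qFactorial_pos k (by omega)).ne'
  have h4 : qFactorial k (k + 1 - m₁) ≠ 0 := (qFactorial_pos k (by omega)).ne'
  generalize qFactorial k (C + 1) = FC1 at *
  generalize qFactorial k (A + 1) = FA1 at *
  generalize qFactorial k (k - C) = FkC at *
  generalize qFactorial k (k - A) = FkA at *
  generalize qFactorial k m₂ = Fm2 at *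
  generalize qFactorial k m₁ = Fm1 at *
  generalize qFactorial k (k + 1 - m₂) = Fkm2 at *
  generalize qFactorial k (k + 1 - m₁) = Fkm1 at *
  generalize qFactorial k (k + 1) = K1 at *
  have key : FkC * FkA * (FA1 * FC1) = Fm1 * Fm2 * (Fkm2 * Fkm1) := by
    linear_combination FkA * FA1 * r1 + K1 * r2 - Fm1 * Fkm1 * r3 - K1 * r4
  rw [div_eq_div_iff (mul_ne_zero h3 h4) (mul_ne_zero h2 h1)]
  linear_combination (qInt k (j + 1) * qFactorial k ((a + j - b) / 2) * qFactorial k ((c + j - d) / 2) *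
    qFactorial k ((d + j - c) / 2) * qFactorial k ((b + j - a) / 2)) * key

/-- The squares of the extremal column are invariant under level conjugation:
`S''_{i,a-b}² = S_{i,a-b}²` for `S'' = S` of the labels `(k-b, k-a, k-d, k-c)`. [folklore] -/
theorem racahSum_col_conj_sq {a b c d i : ℕ} (ha : a ≤ k) (hc : c ≤ k) (hd : d ≤ k) (hba : b ≤ a)
    (hadi : Adm k a d i) (hbci : Adm k b c i) (hcdj : Adm k c d (a - b)) :
    racahSum k (k - b) (k - a) (a - b) (k - d) (k - c) i * racahSum k (k - b) (k - a) (a - b) (k - d) (k - c) i =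
      racahSum k a b (a - b) c d i * racahSum k a b (a - b) c d i := by
  have hik : i ≤ k := by unfold Adm at hadi; omega
  have hb : b ≤ k := hba.trans ha
  have h'' := racahSum_col_single k (a := k - b) (b := k - a) (c := k - d) (d := k - c) (i := i) (by omega)
    ((adm_conj k hb hc).mpr hbci) ((adm_conj k ha hd).mpr hadi)
    (by rw [show k - b - (k - a) = a - b by omega, adm_conj k hd hc]; exact (adm_comm k).mp hcdj)
  rw [show k - b - (k - a) = a - b by omega] at h''
  rw [h'', racahSum_col_single k hba hadi hbci hcdj]
  unfold Adm at hadi hbci hcdj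
  obtain ⟨p1, t1, t2, t3, l1⟩ := hadi
  obtain ⟨p2, s1, s2, s3, l2⟩ := hbci
  obtain ⟨p3, u1, u2, u3, l3⟩ := hcdj
  -- squares of signed quotients
  rw [show ∀ (x A D : ℝ), x * A / D * (x * A / D) = (x * x) * (A * A) / (D * D) from fun x A D => by ring,
    show ∀ (x A D : ℝ), x * A / D * (x * A / D) = (x * x) * (A * A) / (D * D) from fun x A D => by ring,
    ← pow_add, ← pow_add, Even.neg_one_pow ⟨_, rfl⟩, Even.neg_one_pow ⟨_, rfl⟩, one_mul, one_mul]
  -- the halves, division-free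
  generalize hZ : (a + i + d) / 2 = Z
  generalize hu : (b + c - i) / 2 = u
  have hZ2 : 2 * Z = a + i + d := by omega
  have hu2 : 2 * u = b + c - i := by omega
  clear hZ hu
  have e1 : (k - c + i - (k - b)) / 2 = (b + i - c) / 2 := by omega
  have e2 : (k - a + i - (k - d)) / 2 = (d + i - a) / 2 := by clear e1; omega
  have e3 : (k - b + (k - c) - (k - a + (k - d))) / 2 = (a + d - (b + c)) / 2 := by clear e1 e2; omega
  have e4 : (k - a + (k - d) - i) / 2 = k - Z := by clear e1 e2 e3; omega
  have e5 : (k - b + (k - d) - (k - a + (k - c))) / 2 = (a + c - (b + d)) / 2 := by clear e1 e2 e3 e4; omega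
  have e6 : (k - b + i + (k - c)) / 2 + 1 = k + 1 - u := by clear e1 e2 e3 e4 e5; omega
  rw [e1, e2, e3, e4, e5, e6]
  clear e1 e2 e3 e4 e5 e6
  have r1 : qFactorial k u * qFactorial k (k + 1 - u) = qFactorial k (k + 1) := qFactorial_reflect k (by omega)
  have r2 : qFactorial k (Z + 1) * qFactorial k (k - Z) = qFactorial k (k + 1) := by
    rw [show k - Z = k + 1 - (Z + 1) by omega]; exact qFactorial_reflect k (by omega)
  have h1 : qFactorial k ((d + i - a) / 2) ≠ 0 := (qFactorial_pos k (by omega)).ne'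
  have h2 : qFactorial k ((b + i - c) / 2) ≠ 0 := (qFactorial_pos k (by omega)).ne'
  have h3 : qFactorial k ((a + d - (b + c)) / 2) ≠ 0 := (qFactorial_pos k (by omega)).ne'
  have h4 : qFactorial k ((a + c - (b + d)) / 2) ≠ 0 := (qFactorial_pos k (by omega)).ne'
  have h5 : qFactorial k u ≠ 0 := (qFactorial_pos k (by omega)).ne'
  have h6 : qFactorial k (k - Z) ≠ 0 := (qFactorial_pos k (by omega)).ne'
  generalize qFactorial k ((d + i - a) / 2) = F1 at *
  generalize qFactorial k ((b + i - c) / 2) = F2 at *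
  generalize qFactorial k ((a + d - (b + c)) / 2) = F3 at *
  generalize qFactorial k ((a + c - (b + d)) / 2) = F4 at *
  generalize qFactorial k u = Fu at *
  generalize qFactorial k (k - Z) = FkZ at *
  generalize qFactorial k (k + 1 - u) = Fku at *
  generalize qFactorial k (Z + 1) = FZ1 at *
  generalize qFactorial k (k + 1) = K1 at *
  have key : Fku * Fku * (F1 * F2 * F3 * Fu * F4 * (F1 * F2 * F3 * Fu * F4)) =
      FZ1 * FZ1 * (F2 * F1 * F3 * FkZ * F4 * (F2 * F1 * F3 * FkZ * F4)) := by
    have e : Fku * Fu = FZ1 * FkZ := by linear_combination r1 - r2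
    linear_combination (F1 * F2 * F3 * F4) ^ 2 * (Fku * Fu + FZ1 * FkZ) * e
  rw [div_eq_div_iff]
  · exact key
  · exact mul_ne_zero (mul_ne_zero (mul_ne_zero (mul_ne_zero (mul_ne_zero h2 h1) h3) h6) h4)
      (mul_ne_zero (mul_ne_zero (mul_ne_zero (mul_ne_zero h2 h1) h3) h6) h4)
  · exact mul_ne_zero (mul_ne_zero (mul_ne_zero (mul_ne_zero (mul_ne_zero h1 h2) h3) h5) h4)
      (mul_ne_zero (mul_ne_zero (mul_ne_zero (mul_ne_zero h1 h2) h3) h5) h4)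

/-! ### The norm in a normalised orientation, any size -/

/-- **The norm of the extremal column, normalised orientation**: for `b ≤ a`, `|c - d| ≤ a - b`, all labels `≤ k`,
`a - b` a column (`a ≤ b + c + d`, `a + c + d ≤ 2k + b`, even total), `Σ_i ṽ_i S_{i,a-b}² = 1/v_{a-b}` — by
`racahSum_norm_small` directly if `a + b + c + d ≤ 2k`, and applied to the level-conjugate labels otherwise.
[cite: KauffmanLins1994, §9.11–9.13] -/
theorem racahSum_norm_N1 {a b c d : ℕ} (ha : a ≤ k) (hc : c ≤ k) (hd : d ≤ k) (hba : b ≤ a)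
    (hc1 : c ≤ d + (a - b)) (hc2 : d ≤ c + (a - b)) (hj : a ≤ b + c + d) (hlev : a + c + d ≤ 2 * k + b)
    (hpar : (a + b + c + d) % 2 = 0) :
    ∑ i ∈ rowSet k a b c d, racahV k a d c b i * racahSum k a b (a - b) c d i * racahSum k a b (a - b) c d i =
      (racahV k a b c d (a - b))⁻¹ := by
  rcases le_or_gt (a + b + c + d) (2 * k) with hsmall | hlarge
  · exact racahSum_norm_small k ha hba hc1 hc2 hj hpar hsmall
  · have hb : b ≤ k := hba.trans ha
    have h'' := racahSum_norm_small k (a := k - b) (b := k - a) (c := k - d) (d := k - c) (by omega) (by omega)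
      (by omega) (by omega) (by omega) (by omega) (by omega)
    rw [show k - b - (k - a) = a - b by omega, rowSet_conj k ha hb hc hd] at h''
    have hcdj : Adm k c d (a - b) := by unfold Adm; omega
    rw [racahV_conj k hb ha hd hc (by unfold Adm; omega) ((adm_comm k).mp hcdj), racahV_swap12] at h''
    rw [← h'']
    refine sum_congr rfl fun i hi => ?_
    rw [mem_rowSet] at hi
    obtain ⟨hik, hadi, hbci⟩ := hi
    rw [mul_assoc, mul_assoc, racahSum_col_conj_sq k ha hc hd hba hadi hbci hcdj,
      racahV_conj k hb hc hd ha hbci ((adm_comm k).mp hadi)]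
    rw [show racahV k b c d a i = racahV k a d c b i by rw [← racahV_swap13, racahV_swap12]]

/-! ### Orientations -/

/-- The rows of `(b,a,d,c)` are the rows of `(a,b,c,d)`. [folklore] -/
theorem rowSet_swap12 (a b c d : ℕ) : rowSet k b a d c = rowSet k a b c d := by
  unfold rowSet; exact filter_congr fun i _ => and_comm

/-- The rows of `(c,d,a,b)` are the rows of `(a,b,c,d)`. [folklore] -/
theorem rowSet_swap13 (a b c d : ℕ) : rowSet k c d a b = rowSet k a b c d := by
  unfold rowSet
  refine filter_congr fun i _ => ?_
  rw [show Adm k c b i ↔ Adm k b c i from adm_comm k, show Adm k d a i ↔ Adm k a d i from adm_comm k]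
  exact and_comm

/-- The columns of `(b,a,d,c)` are the columns of `(a,b,c,d)`. [folklore] -/
theorem colSet_swap12 (a b c d : ℕ) : colSet k b a d c = colSet k a b c d := by
  unfold colSet
  refine filter_congr fun j _ => ?_
  rw [show Adm k b a j ↔ Adm k a b j from adm_comm k, show Adm k d c j ↔ Adm k c d j from adm_comm k]

/-- The columns of `(c,d,a,b)` are the columns of `(a,b,c,d)`. [folklore] -/
theorem colSet_swap13 (a b c d : ℕ) : colSet k c d a b = colSet k a b c d := by
  unfold colSet; exact filter_congr fun j _ => and_comm

/-- Transfer of the normalised column along an orientation under which all data are invariant. [folklore] -/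
theorem norm_exists_transfer {a b c d a' b' c' d' : ℕ} (hrow : rowSet k a' b' c' d' = rowSet k a b c d)
    (hcol : colSet k a' b' c' d' = colSet k a b c d) (hS : ∀ i j, racahSum k a' b' j c' d' i = racahSum k a b j c d i)
    (hw : ∀ i, racahV k a' d' c' b' i = racahV k a d c b i) (hv : ∀ j, racahV k a' b' c' d' j = racahV k a b c d j)
    (h : ∃ j₀ ∈ colSet k a' b' c' d', ∑ i ∈ rowSet k a' b' c' d',
      racahV k a' d' c' b' i * racahSum k a' b' j₀ c' d' i * racahSum k a' b' j₀ c' d' i = (racahV k a' b' c' d' j₀)⁻¹) :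
    ∃ j₀ ∈ colSet k a b c d, ∑ i ∈ rowSet k a b c d,
      racahV k a d c b i * racahSum k a b j₀ c d i * racahSum k a b j₀ c d i = (racahV k a b c d j₀)⁻¹ := by
  obtain ⟨j₀, hj₀, hsum⟩ := h
  refine ⟨j₀, hcol ▸ hj₀, ?_⟩
  rw [hrow] at hsum
  simp only [hS, hw, hv] at hsum
  exact hsum

/-- In a normalised orientation the column `a - b` is normalised. [folklore] -/
theorem racahSum_norm_exists_N1 {a b c d j : ℕ} (ha : a ≤ k) (hc : c ≤ k) (hd : d ≤ k) (hba : b ≤ a)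
    (hc1 : c ≤ d + (a - b)) (hc2 : d ≤ c + (a - b)) (hj : j ∈ colSet k a b c d) :
    ∃ j₀ ∈ colSet k a b c d, ∑ i ∈ rowSet k a b c d,
      racahV k a d c b i * racahSum k a b j₀ c d i * racahSum k a b j₀ c d i = (racahV k a b c d j₀)⁻¹ := by
  rw [mem_colSet] at hj
  obtain ⟨hjk, habj, hcdj⟩ := hj
  unfold Adm at habj hcdj
  refine ⟨a - b, (mem_colSet k).mpr ⟨by omega, by unfold Adm; omega, by unfold Adm; omega⟩, ?_⟩
  exact racahSum_norm_N1 k ha hc hd hba hc1 hc2 (by omega) (by omega) (by omega)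

/-- **Every configuration has a normalised column**: for labels `≤ k` with a non-empty column set, some column
`j₀` has `Σ_i ṽ_i S_{ij₀}² = 1/v_{j₀}`. [cite: KauffmanLins1994, §9.11–9.13] -/
theorem racahSum_norm_exists {a b c d j : ℕ} (ha : a ≤ k) (hb : b ≤ k) (hc : c ≤ k) (hd : d ≤ k)
    (hj : j ∈ colSet k a b c d) :
    ∃ j₀ ∈ colSet k a b c d, ∑ i ∈ rowSet k a b c d,
      racahV k a d c b i * racahSum k a b j₀ c d i * racahSum k a b j₀ c d i = (racahV k a b c d j₀)⁻¹ := by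
  have hj' := hj
  rw [mem_colSet] at hj'
  obtain ⟨hjk, habj, hcdj⟩ := hj'
  unfold Adm at habj hcdj
  by_cases h1 : b ≤ a ∧ c ≤ d + (a - b) ∧ d ≤ c + (a - b)
  · exact racahSum_norm_exists_N1 k ha hc hd h1.1 h1.2.1 h1.2.2 hj
  by_cases h2 : a ≤ b ∧ d ≤ c + (b - a) ∧ c ≤ d + (b - a)
  · -- orientation `(b,a,d,c)`
    refine norm_exists_transfer k (rowSet_swap12 k a b c d) (colSet_swap12 k a b c d)
      (fun i j => racahSum_swap12 k a b c d i j) (fun i => ?_) (fun j => racahV_swap12 k a b c d j)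
      (racahSum_norm_exists_N1 k hb hd hc h2.1 h2.2.1 h2.2.2 (by rw [colSet_swap12]; exact hj))
    rw [← racahV_swap13, racahV_swap12]
  by_cases h3 : d ≤ c ∧ a ≤ b + (c - d) ∧ b ≤ a + (c - d)
  · -- orientation `(c,d,a,b)`
    refine norm_exists_transfer k (rowSet_swap13 k a b c d) (colSet_swap13 k a b c d)
      (fun i j => racahSum_swap13 k a b c d i j) (fun i => ?_) (fun j => racahV_swap13 k a b c d j)
      (racahSum_norm_exists_N1 k hc ha hb h3.1 h3.2.1 h3.2.2 (by rw [colSet_swap13]; exact hj))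
    rw [← racahV_swap12, racahV_swap13, racahV_swap12]
  · -- orientation `(d,c,b,a)`
    have h4 : c ≤ d ∧ b ≤ a + (d - c) ∧ a ≤ b + (d - c) := by omega
    have hj4 : j ∈ colSet k d c b a := by rw [colSet_swap12, colSet_swap13]; exact hj
    refine norm_exists_transfer k (by rw [rowSet_swap12, rowSet_swap13]) (by rw [colSet_swap12, colSet_swap13])
      (fun i j => by rw [racahSum_swap12, racahSum_swap13]) (fun i => ?_)
      (fun j => by rw [racahV_swap12, racahV_swap13])
      (racahSum_norm_exists_N1 k hd hb ha h4.1 h4.2.1 h4.2.2 hj4)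
    rw [racahV_swap12]

/-- **Orthogonality of the Kauffman–Lins Racah sums with the predicted norms** (all labels `≤ k`, level `k ≥ 1`):
for `j, j'` columns, `Σ_{i ∈ I} ṽ_i S_{ij} S_{ij'} = δ_{jj'}/v_j`. This is the discrete orthogonality of the `q`-Racah
polynomials at the root of unity `q = e^{iπ/(k+2)}` in Kauffman–Lins' variables.
[cite: KauffmanLins1994, §7.3 Prop. 9, §9.13] [cite: GasperRahman2004, §7.2 eq. (7.2.18)] -/
theorem racahSum_gram (hk : 1 ≤ k) {a b c d j j' : ℕ} (ha : a ≤ k) (hb : b ≤ k) (hc : c ≤ k) (hd : d ≤ k)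
    (hj : j ∈ colSet k a b c d) (hj' : j' ∈ colSet k a b c d) :
    ∑ i ∈ rowSet k a b c d, racahV k a d c b i * racahSum k a b j c d i * racahSum k a b j' c d i =
      if j = j' then (racahV k a b c d j)⁻¹ else 0 := by
  obtain ⟨j₀, hj₀, hnorm⟩ := racahSum_norm_exists k ha hb hc hd hj
  exact racahSum_gram_of_norm k hk hj₀ hnorm hj hj'

end Literature.RepresentationTheory.ModularTensorCategories.SU2LevelK
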